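import Summits.ResolutionOfSingularities.ResolutionOfSingularities.Theorems.EquisingularLiftEquisingularLiftNatNosePackage
import Summits.ResolutionOfSingularities.ResolutionOfSingularities.Theorems.EquisingularLiftEquisingularLiftNatPointResolutionRel
import Summits.ResolutionOfSingularities.ResolutionOfSingularities.Theorems.EquisingularLiftEquisingularLiftNatLinearCentre
import HarnessLib

/-!
# [OURS · L1 W4.5(b) · EL♮] (5) T-NOSE-THEN-POINTS «an `O`-smooth nose, then point steps» — the conditional rung for
# `stub_elnat_three_nonisolated` (res-L1-w45b-lead-2's TARGET (5), STATUS 2026-08-27T07:04:41Z; = nose package + res-type-022's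
# T-ISO-0-REL p509452), any `n`

Crux `EquisingularLiftNat` = stmt-ResolutionOfSingularities-20038 (route EquisingularLift), line `sections`; helper file
`--supports … --as helper` by res-type-051 (TAKING 2026-08-27T07:23:26Z). HONEST FRAMING: OURS (cell res-hironaka, slot W4.5(b));
NOT a statement of any manuscript; a CONDITIONAL rung: hypothesis (a) «an `O`-SMOOTH lift `C` of the nose with `ι(H) ⊄ V(Λ) ⊆ ι(H)`»
is a LIFT₃-type hypothesis (open in print for general space curves `Σ`; fine for linear / ACM `Σ`), hypothesis (b) «after the blow-up
of `ℙⁿ_k` along `Λ` the strict transform of `H` is resolved by finitely many point blow-ups» is the classical downstairs input. With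
this file the census of `stub_elnat_three_nonisolated` reads «(a) + (b)» in the kernel (lead-2). AI-written, weaker than expert
review. No `sorry`; standard axioms.

* `elNatBody_of_noseThenPoints` — the `∃ (P′, σ, S′)` body of the item for `Y = g(ι(H))`: `nosePackage₀` (…NatNosePackage.lean) at a
  blow-up of `ℙⁿ_O` along `C` (`exists_isBlowup`), then `pointResolution_from_horizStage` (p509452) from the new stage — whose
  ambient has good reduction everywhere BECAUSE the nose centre is `O`-smooth —, then the item's E1-chain clause from the horizontal
  E1 closure (p500485, forgetting flatness).
* `elNatOver_of_noseThenPoints` / `elNatAt_of_noseThenPoints` — packaged as `Theorems.EquisingularLift.ELNatOver` / `ELNatAt`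
  (p503491), with `Λ` given on `ℙⁿ_k` and `C · 𝒪_{ℙⁿ_k} = Λ` along EVERY graded `φ` inducing `MvPolynomial.map π` (the `hKEY` device
  of `elNatOver_of_oneStep₀`). `O` is a COMPLETE characteristic-0 DVR with algebraically closed residue field (Hensel sections).
* `LinearCentre.smooth_kerSubschemeι_comp` — adapter for LINEAR `Σ` (R1/R2, pinch points): the linear centre `V(Λ) ≅ ℙ^r_O` of
  …NatLinearCentre.lean is SMOOTH over `Spec O` (its `flat_kerSubschemeι_comp` with `Flat` replaced by `Smooth`), i.e. hypothesis (a)'s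
  smoothness clause for the centres of `linearCentre_stepData`.

ORDER OF STEPS. Nose FIRST, then points (R2 Whitney cubic: zero points; pinch points: zero points). The other order — a point
prefix BEFORE the nose (triple points of generic projections) — is formally available from `noseStep` at a general `O`-smooth stage
composed with `pointResolution_rel_smooth`, but then the exactness of the nose lift at the prefix stage is a hypothesis about an
abstract stage that no specimen can discharge concretely; it is NOT packaged here (say so to lead-2 if a specimen needs it).

References: …NatNosePackage.lean, …NatNoseStep.lean, …NatPointResolutionRel.lean (p509452), …NatOneStep.lean (p505461),
…CampaignW45bELNatAt.lean (p503491); Liu 2002 §8.1/§9.2; res-L1-w45b-lead-2 TARGETS (4)(5) 2026-08-27T07:04:41Z; L/w45b/CHAIN.md v7.2.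
-/

set_option linter.dupNamespace false -- mandated namespace `Summit.<Summit>.<Problem>` of this single-conjunct summit
set_option linter.overlappingInstances false -- signatures carry `[IsDomain O] [IsDiscreteValuationRing O]`

noncomputable section

open CategoryTheory CategoryTheory.Limits AlgebraicGeometry TopologicalSpace Topology
open MvPolynomial
open Literature.AlgebraicGeometry.Resolution
open AlgebraicGeometry.Scheme.IdealSheafData
open Summit.ResolutionOfSingularities.ResolutionOfSingularities.Theses.EquisingularLift.Split
open Summit.ResolutionOfSingularities.ResolutionOfSingularities.Cruxes.EquisingularLift.StrataSplit

attribute [local instance] MvPolynomial.gradedAlgebra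

namespace Summit.ResolutionOfSingularities.ResolutionOfSingularities.Cruxes.EquisingularLiftNat.Sections

/-! ## (5) T-NOSE-THEN-POINTS: the nose out of `ℙⁿ_O`, then point steps (res-type-022's T-ISO-0-REL, p509452) -/

/-- **(5) T-NOSE-THEN-POINTS, the `∃ (P′, σ, S′)` body of the EL♮ item** (module docstring for the reading). `O` a complete DVR
with algebraically closed residue field and a surjection `π : O → k`, `ι : H → ℙⁿ_k` a closed immersion of an integral scheme,
`φ` graded inducing `MvPolynomial.map π`, `Y = (ι ≫ Proj φ)(H)`. If (a) `C` is an ideal sheaf on `ℙⁿ_O` with `V(C) → Spec O` SMOOTH,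
`ι(H) ⊄ V(Λ)` and `V(Λ) ⊆ ι(H)` for `Λ = C · 𝒪_{ℙⁿ_k}`, and (b) for some blow-up `υ : F₂ → ℙⁿ_k` along `Λ` the strict transform
`closure υ⁻¹(ι(H) ∖ V(Λ))` is resolved by finitely many blow-ups of the successive ambients at non-regular closed points of the
successive reduced strict transforms, then some `(P′, σ, S′)` in the item's E1-chain closure of `(ℙⁿ_O, 𝟙, Y)` has irreducible
special fibre and regular `V(closure S′)_red`. [folklore; Liu 2002 §8.1/§9.2] -/
theorem elNatBody_of_noseThenPoints (O : Type) [CommRing O] [IsDomain O] [IsDiscreteValuationRing O]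
    [IsAdicComplete (IsLocalRing.maximalIdeal O) O] [IsAlgClosed (IsLocalRing.ResidueField O)]
    (k : Type) [Field k] (π : O →+* k) (hπ : Function.Surjective π) (n : ℕ) (H : Scheme.{0})
    (ι : H ⟶ Proj (homogeneousSubmodule (Fin (n + 1)) k)) [IsClosedImmersion ι] [IsIntegral H]
    (φ : homogeneousSubmodule (Fin (n + 1)) O →+*ᵍ homogeneousSubmodule (Fin (n + 1)) k)
    (hφ' : HomogeneousIdeal.irrelevant (homogeneousSubmodule (Fin (n + 1)) k) ≤
      (HomogeneousIdeal.irrelevant (homogeneousSubmodule (Fin (n + 1)) O)).map φ)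
    (hφ : ∀ s, φ s = MvPolynomial.map π s)
    -- (a) THE NOSE: a centre of `ℙⁿ_O` smooth over `O` with `ι(H) ⊄ V(Λ) ⊆ ι(H)`, `Λ = C · 𝒪_{ℙⁿ_k}`
    (C : (Proj (homogeneousSubmodule (Fin (n + 1)) O)).IdealSheafData)
    (hCsm : Smooth (C.subschemeι ≫ Proj.toSpecZero (homogeneousSubmodule (Fin (n + 1)) O) ≫
      Spec.map (CommRingCat.ofHom (algebraMap O (homogeneousSubmodule (Fin (n + 1)) O 0)))))
    (hgen : ¬ (Set.range ι ⊆ ((C.comap (Proj.map φ hφ')).support : Set (Proj (homogeneousSubmodule (Fin (n + 1)) k)))))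
    (hsupp : ((C.comap (Proj.map φ hφ')).support : Set (Proj (homogeneousSubmodule (Fin (n + 1)) k))) ⊆ Set.range ι)
    -- (b) THEN POINTS: after some blow-up of `ℙⁿ_k` along `Λ` the strict transform of `ι(H)` is point-resolvable
    (hdown : ∃ (F₂ : Scheme.{0}) (υ : F₂ ⟶ Proj (homogeneousSubmodule (Fin (n + 1)) k)),
      IsBlowup υ (C.comap (Proj.map φ hφ')) ∧
      ∃ (F' : Scheme.{0}) (ρ' : F' ⟶ F₂) (T' : Set F'),
        (∀ Q : (∀ F₁ : Scheme.{0}, (F₁ ⟶ F₂) → Set F₁ → Prop),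
          Q F₂ (𝟙 F₂) (closure (υ ⁻¹' (Set.range ι \
            ((C.comap (Proj.map φ hφ')).support : Set (Proj (homogeneousSubmodule (Fin (n + 1)) k)))))) →
          (∀ (F₁ F₃ : Scheme.{0}) (ρ : F₁ ⟶ F₂) (T₁ : Set F₁)
            (x : ↥(vanishingIdeal (⟨closure T₁, isClosed_closure⟩ : Closeds F₁)).subscheme) (υ₁ : F₃ ⟶ F₁)
            (hx : IsClosed ({((vanishingIdeal (⟨closure T₁, isClosed_closure⟩ : Closeds F₁)).subschemeι x : F₁)} : Set F₁)),
            Q F₁ ρ T₁ →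
            ¬ IsRegularLocalRing ((vanishingIdeal (⟨closure T₁, isClosed_closure⟩ : Closeds F₁)).subscheme.presheaf.stalk x) →
            IsBlowup υ₁ (vanishingIdeal
              (⟨{((vanishingIdeal (⟨closure T₁, isClosed_closure⟩ : Closeds F₁)).subschemeι x : F₁)}, hx⟩ : Closeds F₁)) →
            Q F₃ (υ₁ ≫ ρ) (closure (υ₁ ⁻¹' (T₁ \
              {((vanishingIdeal (⟨closure T₁, isClosed_closure⟩ : Closeds F₁)).subschemeι x : F₁)})))) →
          Q F' ρ' T') ∧
        Scheme.IsRegular (vanishingIdeal (⟨closure T', isClosed_closure⟩ : Closeds F')).subscheme) :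
    ∀ Y : Set (Proj (homogeneousSubmodule (Fin (n + 1)) O)), Y = Set.range (ι ≫ Proj.map φ hφ') →
    ∃ (P' : Scheme.{0}) (σ : P' ⟶ Proj (homogeneousSubmodule (Fin (n + 1)) O)) (S' : Set P'),
      (∀ Q : (∀ X' : Scheme.{0}, (X' ⟶ Proj (homogeneousSubmodule (Fin (n + 1)) O)) → Set X' → Prop),
        Q (Proj (homogeneousSubmodule (Fin (n + 1)) O)) (𝟙 _) Y →
        (∀ (X' X'' : Scheme.{0}) (σ' : X' ⟶ Proj (homogeneousSubmodule (Fin (n + 1)) O)) (Y' : Set X')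
          (C : X'.IdealSheafData) (τ : X'' ⟶ X'), Q X' σ' Y' → IsBlowup τ C → Scheme.IsRegular C.subscheme →
          σ' '' (C.support : Set X') ⊆ {x | ¬ IsGenericPoint x Y} →
          (C.support : Set X') ∩ (σ' ≫ (Proj.toSpecZero (homogeneousSubmodule (Fin (n + 1)) O) ≫
            Spec.map (CommRingCat.ofHom (algebraMap O (homogeneousSubmodule (Fin (n + 1)) O 0))))) ⁻¹'
            {IsLocalRing.closedPoint O} ⊆ Y' →
          Q X'' (τ ≫ σ') (closure (τ ⁻¹' (Y' \ (C.support : Set X'))))) → Q P' σ S') ∧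
      IsIrreducible ((σ ≫ (Proj.toSpecZero (homogeneousSubmodule (Fin (n + 1)) O) ≫
        Spec.map (CommRingCat.ofHom (algebraMap O (homogeneousSubmodule (Fin (n + 1)) O 0))))) ⁻¹'
        {IsLocalRing.closedPoint O}) ∧
      Scheme.IsRegular (vanishingIdeal (⟨closure S', isClosed_closure⟩ : Closeds P')).subscheme := by
  classical
  set q : (Proj (homogeneousSubmodule (Fin (n + 1)) O)) ⟶ Spec (.of O) := Proj.toSpecZero (homogeneousSubmodule (Fin (n + 1)) O) ≫
    Spec.map (CommRingCat.ofHom (algebraMap O (homogeneousSubmodule (Fin (n + 1)) O 0))) with hqdef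
  intro Y hY
  obtain ⟨F₂, υ, hυ, hres⟩ := hdown
  -- the nose: blow `ℙⁿ_O` up along `C`
  obtain ⟨P₁, τ, hτ⟩ := exists_isBlowup (Proj (homogeneousSubmodule (Fin (n + 1)) O)) C
  obtain ⟨hYcl, hYirr, hYs, hH₁, hirr₁, hgood₁, hF₂, hirrD, ⟨e⟩, -⟩ :=
    nosePackage₀ O k π hπ n H ι φ hφ' hφ C hCsm hgen hsupp P₁ τ hτ F₂ υ hυ Y hY
  haveI := hF₂
  obtain ⟨hsm, hpr⟩ := stub_projectiveAmbientSmoothProper O n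
  have hint := isIntegral_specialFibre_projectiveSpace O n
  let Yc : Closeds (Proj (homogeneousSubmodule (Fin (n + 1)) O)) := ⟨Y, hYcl⟩
  -- then points: T-ISO-0-REL from the stage `(P₁, τ, closure τ⁻¹(Y ∖ V(C)))`
  obtain ⟨X₂, σ₂, S₂, hH₂, hirr₂, -, hreg₂⟩ := pointResolution_from_horizStage O (Proj (homogeneousSubmodule (Fin (n + 1)) O))
    q Yc hsm hpr hYs hYirr P₁ τ (closure (τ ⁻¹' (Y \ (C.support : Set (Proj (homogeneousSubmodule (Fin (n + 1)) O))))))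
    hH₁ hirr₁ (fun w _ => hgood₁ w) F₂
    (closure (υ ⁻¹' (Set.range ι \ ((C.comap (Proj.map φ hφ')).support : Set (Proj (homogeneousSubmodule (Fin (n + 1)) k))))))
    isClosed_closure hirrD e hres
  -- the item's E1-chain clause forgets flatness
  obtain ⟨hchain, -⟩ := natChain_and_isIrreducible_of_horizChainE1 O (Proj (homogeneousSubmodule (Fin (n + 1)) O)) X₂ q Y σ₂ S₂
    hsm hpr hint hYirr hYcl hYs hH₂
  exact ⟨X₂, σ₂, S₂, hchain, hirr₂, hreg₂⟩

/-- **`ELNatOver` FROM (5) T-NOSE-THEN-POINTS.** For an integral `H` with a closed immersion `ι : H → ℙⁿ_k`, a COMPLETE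
characteristic-0 DVR `O` with algebraically closed residue field and a surjection `π : O → k`, an `O`-SMOOTH centre `C` of `ℙⁿ_O`,
and an ideal sheaf `Λ` on `ℙⁿ_k` with `C · 𝒪_{ℙⁿ_k} = Λ` along EVERY graded `φ` inducing `MvPolynomial.map π`: if `ι(H) ⊄ V(Λ) ⊆ ι(H)`
and, after some blow-up of `ℙⁿ_k` along `Λ`, the strict transform of `ι(H)` is resolved by finitely many point blow-ups (PtChain
∃-form of T-ISO-0), then `ELNatOver p k n H ι O π` (p503491). [folklore] -/
theorem elNatOver_of_noseThenPoints {p : ℕ} (k : Type) [Field k] [CharP k p] [IsAlgClosed k] (n : ℕ) (H : Scheme.{0})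
    (ι : H ⟶ (Literature.AlgebraicGeometry.Motives.projectiveSpace n k).left) [IsClosedImmersion ι] [IsIntegral H]
    (O : Type) [CommRing O] [IsDomain O] [IsDiscreteValuationRing O] [CharZero O]
    [IsAdicComplete (IsLocalRing.maximalIdeal O) O] [IsAlgClosed (IsLocalRing.ResidueField O)]
    (π : O →+* k) (hπ : Function.Surjective π)
    (C : (Proj (homogeneousSubmodule (Fin (n + 1)) O)).IdealSheafData)
    (hCsm : Smooth (C.subschemeι ≫ Proj.toSpecZero (homogeneousSubmodule (Fin (n + 1)) O) ≫
      Spec.map (CommRingCat.ofHom (algebraMap O (homogeneousSubmodule (Fin (n + 1)) O 0)))))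
    (Λ : (Proj (homogeneousSubmodule (Fin (n + 1)) k)).IdealSheafData)
    (hKEY : ∀ (φ : homogeneousSubmodule (Fin (n + 1)) O →+*ᵍ homogeneousSubmodule (Fin (n + 1)) k)
      (hφ' : HomogeneousIdeal.irrelevant (homogeneousSubmodule (Fin (n + 1)) k) ≤
        (HomogeneousIdeal.irrelevant (homogeneousSubmodule (Fin (n + 1)) O)).map φ),
      (∀ s, φ s = MvPolynomial.map π s) → C.comap (Proj.map φ hφ') = Λ)
    (hgen : ¬ (Set.range ι ⊆ (Λ.support : Set (Proj (homogeneousSubmodule (Fin (n + 1)) k)))))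
    (hsupp : (Λ.support : Set (Proj (homogeneousSubmodule (Fin (n + 1)) k))) ⊆ Set.range ι)
    (hdown : ∃ (F₂ : Scheme.{0}) (υ : F₂ ⟶ Proj (homogeneousSubmodule (Fin (n + 1)) k)), IsBlowup υ Λ ∧
      ∃ (F' : Scheme.{0}) (ρ' : F' ⟶ F₂) (T' : Set F'),
        (∀ Q : (∀ F₁ : Scheme.{0}, (F₁ ⟶ F₂) → Set F₁ → Prop),
          Q F₂ (𝟙 F₂) (closure (υ ⁻¹' (Set.range ι \ (Λ.support : Set (Proj (homogeneousSubmodule (Fin (n + 1)) k)))))) →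
          (∀ (F₁ F₃ : Scheme.{0}) (ρ : F₁ ⟶ F₂) (T₁ : Set F₁)
            (x : ↥(vanishingIdeal (⟨closure T₁, isClosed_closure⟩ : Closeds F₁)).subscheme) (υ₁ : F₃ ⟶ F₁)
            (hx : IsClosed ({((vanishingIdeal (⟨closure T₁, isClosed_closure⟩ : Closeds F₁)).subschemeι x : F₁)} : Set F₁)),
            Q F₁ ρ T₁ →
            ¬ IsRegularLocalRing ((vanishingIdeal (⟨closure T₁, isClosed_closure⟩ : Closeds F₁)).subscheme.presheaf.stalk x) →
            IsBlowup υ₁ (vanishingIdeal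
              (⟨{((vanishingIdeal (⟨closure T₁, isClosed_closure⟩ : Closeds F₁)).subschemeι x : F₁)}, hx⟩ : Closeds F₁)) →
            Q F₃ (υ₁ ≫ ρ) (closure (υ₁ ⁻¹' (T₁ \
              {((vanishingIdeal (⟨closure T₁, isClosed_closure⟩ : Closeds F₁)).subschemeι x : F₁)})))) →
          Q F' ρ' T') ∧
        Scheme.IsRegular (vanishingIdeal (⟨closure T', isClosed_closure⟩ : Closeds F')).subscheme) :
    Theorems.EquisingularLift.ELNatOver p k n H ι O π := by
  intro φ hφ' hφ Y hY
  let ι' : H ⟶ Proj (homogeneousSubmodule (Fin (n + 1)) k) := ι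
  haveI : IsClosedImmersion ι' := ‹IsClosedImmersion ι›
  have hK := hKEY φ hφ' hφ
  exact elNatBody_of_noseThenPoints O k π hπ n H ι' φ hφ' hφ C hCsm (by rw [hK]; exact hgen)
    (by rw [hK]; exact hsupp) (by rw [hK]; exact hdown) Y hY

/-- **`ELNatAt` FROM (5) T-NOSE-THEN-POINTS** — the same packaged with `elNatAt_of_elNatOver`. [folklore] -/
theorem elNatAt_of_noseThenPoints {p : ℕ} (k : Type) [Field k] [CharP k p] [IsAlgClosed k] (n : ℕ) (H : Scheme.{0})
    (ι : H ⟶ (Literature.AlgebraicGeometry.Motives.projectiveSpace n k).left) [IsClosedImmersion ι] [IsIntegral H]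
    (O : Type) [CommRing O] [IsDomain O] [IsDiscreteValuationRing O] [CharZero O]
    [IsAdicComplete (IsLocalRing.maximalIdeal O) O] [IsAlgClosed (IsLocalRing.ResidueField O)]
    (π : O →+* k) (hπ : Function.Surjective π)
    (C : (Proj (homogeneousSubmodule (Fin (n + 1)) O)).IdealSheafData)
    (hCsm : Smooth (C.subschemeι ≫ Proj.toSpecZero (homogeneousSubmodule (Fin (n + 1)) O) ≫
      Spec.map (CommRingCat.ofHom (algebraMap O (homogeneousSubmodule (Fin (n + 1)) O 0)))))
    (Λ : (Proj (homogeneousSubmodule (Fin (n + 1)) k)).IdealSheafData)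
    (hKEY : ∀ (φ : homogeneousSubmodule (Fin (n + 1)) O →+*ᵍ homogeneousSubmodule (Fin (n + 1)) k)
      (hφ' : HomogeneousIdeal.irrelevant (homogeneousSubmodule (Fin (n + 1)) k) ≤
        (HomogeneousIdeal.irrelevant (homogeneousSubmodule (Fin (n + 1)) O)).map φ),
      (∀ s, φ s = MvPolynomial.map π s) → C.comap (Proj.map φ hφ') = Λ)
    (hgen : ¬ (Set.range ι ⊆ (Λ.support : Set (Proj (homogeneousSubmodule (Fin (n + 1)) k)))))
    (hsupp : (Λ.support : Set (Proj (homogeneousSubmodule (Fin (n + 1)) k))) ⊆ Set.range ι)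
    (hdown : ∃ (F₂ : Scheme.{0}) (υ : F₂ ⟶ Proj (homogeneousSubmodule (Fin (n + 1)) k)), IsBlowup υ Λ ∧
      ∃ (F' : Scheme.{0}) (ρ' : F' ⟶ F₂) (T' : Set F'),
        (∀ Q : (∀ F₁ : Scheme.{0}, (F₁ ⟶ F₂) → Set F₁ → Prop),
          Q F₂ (𝟙 F₂) (closure (υ ⁻¹' (Set.range ι \ (Λ.support : Set (Proj (homogeneousSubmodule (Fin (n + 1)) k)))))) →
          (∀ (F₁ F₃ : Scheme.{0}) (ρ : F₁ ⟶ F₂) (T₁ : Set F₁)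
            (x : ↥(vanishingIdeal (⟨closure T₁, isClosed_closure⟩ : Closeds F₁)).subscheme) (υ₁ : F₃ ⟶ F₁)
            (hx : IsClosed ({((vanishingIdeal (⟨closure T₁, isClosed_closure⟩ : Closeds F₁)).subschemeι x : F₁)} : Set F₁)),
            Q F₁ ρ T₁ →
            ¬ IsRegularLocalRing ((vanishingIdeal (⟨closure T₁, isClosed_closure⟩ : Closeds F₁)).subscheme.presheaf.stalk x) →
            IsBlowup υ₁ (vanishingIdeal
              (⟨{((vanishingIdeal (⟨closure T₁, isClosed_closure⟩ : Closeds F₁)).subschemeι x : F₁)}, hx⟩ : Closeds F₁)) →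
            Q F₃ (υ₁ ≫ ρ) (closure (υ₁ ⁻¹' (T₁ \
              {((vanishingIdeal (⟨closure T₁, isClosed_closure⟩ : Closeds F₁)).subschemeι x : F₁)})))) →
          Q F' ρ' T') ∧
        Scheme.IsRegular (vanishingIdeal (⟨closure T', isClosed_closure⟩ : Closeds F')).subscheme) :
    Theorems.EquisingularLift.ELNatAt p k n H ι :=
  Theorems.EquisingularLift.elNatAt_of_elNatOver hπ
    (elNatOver_of_noseThenPoints k n H ι O π hπ C hCsm Λ hKEY hgen hsupp hdown)

end Summit.ResolutionOfSingularities.ResolutionOfSingularities.Cruxes.EquisingularLiftNat.Sections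

/-! ## Adapter: linear centres are smooth over `O` (hypothesis (a) for linear `Σ`) -/

namespace Summit.ResolutionOfSingularities.ResolutionOfSingularities.Cruxes.EquisingularLiftNat.LinearCentre

section OverO

variable {O : Type} [CommRing O] {N r : ℕ} (e : Fin (r + 1) → Fin (N + 1))
  (fO : (homogeneousSubmodule (Fin (N + 1)) O) →+*ᵍ (homogeneousSubmodule (Fin (r + 1)) O))
  (hfO' : HomogeneousIdeal.irrelevant (homogeneousSubmodule (Fin (r + 1)) O) ≤
    (HomogeneousIdeal.irrelevant (homogeneousSubmodule (Fin (N + 1)) O)).map fO)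
  (hfOC : ∀ a : O, fO (C a) = C a) (hfOe : ∀ j : Fin (r + 1), fO (X (e j)) = X j)

include hfOC hfOe in
/-- **The linear centre is SMOOTH over `Spec O`**: `V(Λ) → ℙ^N_O → Spec O` is, through `V(Λ) ≅ ℙ^r_O` (image of the closed
immersion `Proj f_O` of the kill map), the structure morphism of `ℙ^r_O` (`projMap_kill_comp_structureMap`), which is smooth
(`stub_projectiveAmbientSmoothProper`). This is the smoothness clause of hypothesis (a) of `elNatBody_of_noseThenPoints` for the
linear centres of `linearCentre_stepData` (…NatLinearCentre.lean). [cite: Hartshorne1977, II Ex. 3.12 (a); III Thm. 10.2] -/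
theorem smooth_kerSubschemeι_comp :
    Smooth ((Proj.map fO hfO').ker.subschemeι ≫ (Proj.toSpecZero (homogeneousSubmodule (Fin (N + 1)) O) ≫
      Spec.map (CommRingCat.ofHom (algebraMap O ((homogeneousSubmodule (Fin (N + 1)) O) 0))))) := by
  -- adapted from `LinearCentre.flat_kerSubschemeι_comp` (…NatLinearCentre.lean), with `Flat` replaced by `Smooth`
  haveI := isClosedImmersion_projMap_kill e fO hfO' hfOC hfOe
  set iO := Proj.map fO hfO' with hiO
  have h1 : iO.toImage ≫ iO.ker.subschemeι ≫ (Proj.toSpecZero (homogeneousSubmodule (Fin (N + 1)) O) ≫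
        Spec.map (CommRingCat.ofHom (algebraMap O ((homogeneousSubmodule (Fin (N + 1)) O) 0)))) =
      Proj.toSpecZero (homogeneousSubmodule (Fin (r + 1)) O) ≫
        Spec.map (CommRingCat.ofHom (algebraMap O (homogeneousSubmodule (Fin (r + 1)) O 0))) := by
    rw [← Category.assoc]
    change (iO.toImage ≫ iO.imageι) ≫ _ = _
    rw [Scheme.Hom.toImage_imageι]
    exact projMap_kill_comp_structureMap e fO hfO' hfOC hfOe
  haveI := (stub_projectiveAmbientSmoothProper O r).1
  have h2 : Smooth (iO.toImage ≫ iO.ker.subschemeι ≫ (Proj.toSpecZero (homogeneousSubmodule (Fin (N + 1)) O) ≫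
      Spec.map (CommRingCat.ofHom (algebraMap O ((homogeneousSubmodule (Fin (N + 1)) O) 0))))) := by
    rw [h1]; infer_instance
  exact (MorphismProperty.cancel_left_of_respectsIso @Smooth iO.toImage _).mp h2

end OverO

end Summit.ResolutionOfSingularities.ResolutionOfSingularities.Cruxes.EquisingularLiftNat.LinearCentre

end
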